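import Summits.KontsevichZagierPeriods.Zeta5Search.WedgeDictionaryLevelDescent
import Literature.NumberTheory.Irrationality.BrownZudilin2022.DescentToZetaThree
import Literature.NumberTheory.Irrationality.Zudilin2004.GroupStructureZeta3
import HarnessLib

/-!
# Transport of Brown–Zudilin (22) to the dual side: the dictionary lemmas (gen-1 g10)

HONEST FRAMING: systematic search; no irrationality claim unless certified.

OUR work (Summit side; cell `pub-zeta5`, planner gen-1 g10, 2026-08-20).  The term-by-term DICTIONARY between the `k`-th
companion integral of Brown–Zudilin's residue formula (22) (`Literature/…/BrownZudilin2022/DescentToZetaThree`: `J3`, `w22`)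
and the `i`-th degenerate shape of the cell's level descent (`WedgeDictionaryLevelDescent`: `degShape`, `ldWeight`), with
`i = k − p₄`.  Everything in this file is PROVED (the cited Zudilin 2002 theorem enters (i) as a named hypothesis):

* (i) `J3_eq_vwpDual_five`: `J₃(p₀,p₁,p₂,p₃−k; q₁,q₂,q₃−p₆+k) = λ_k·F̃₅(B(k))` with
  `B(k) = (p₁+q₁+q₂; p₀, p₃−k, p₁, q₂, p₁+q₁−p₂)` (`bFive`, `lamQ`), from `Zudilin2002.vwp_eq_integral_of_pos` (k = 3) for
  STRICTLY admissible `B(k)` (`vwpDual_five_eq_J` is the coordinate form for any admissible level-5 vector);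
* (ii) `tau134_bFive`: Zudilin's involution `𝔱₁₃₄` maps `B(k)` to `(N; b₃, b₇−i, b₄, b₆, b₅)` (`tShape`), `N = b₀`, `b = b(a)`;
* (iii) `vwpDual_tShape`: `F̃₅(N; b₃, b₇−i, b₄, b₆, b₅) = F̃₇(degShape b i)` (slot symmetry `vwpDual_comp_swap` and the
  cancellation of the slot pair `(N+1, 0)`, `vwpDual_seven_slot_pair`); `piNorm_bFive`, `piNorm_tShape` evaluate `Π`;
* (iv) `transportWeight`: `w_k·λ_k·Π(B(k)) = 2ρ(a)·Ω_i(b)·Π(𝔱B(k))` (`transportWeight_stmt`) — a pure RELABELLING of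
  factorials through the relations (18)–(19) of the source, which hold identically on the 8-parameter family (`ring_nf` +
  `field_simp` after unfolding; no summation identity is involved).  Exact-arithmetic cross-check before formalisation:
  `code/gen1/g10/weights_check.py` (5017/5017 sampled terms).

Used by `WedgeDictionaryDescent22` (the reduction of the `P̂`-third of the analytic wedge dictionary to (22)).  Nothing here
is citable literature; nothing here bears on irrationality.
-/

noncomputable section

open Finset

namespace Summit.KontsevichZagierPeriods.Zeta5Search.WedgeDictionary

open Summit.KontsevichZagierPeriods.Zeta5Search.DualSeries
open Literature.NumberTheory.Irrationality.BrownZudilin2022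
  (vwpDual hOfB bOfA pOf qOf Converges cellularIntegral QOf zchoose J3 w22 rhs22 J3TermsConverge descent22)
open Literature.NumberTheory.Irrationality.Zudilin2002 (vwpSeries sorokinIntegral sorokinIntegrand vwp_eq_integral_of_pos)
open Literature.NumberTheory.Irrationality.Zudilin2004 (Admissible cParams piNorm tau134 baileyTransform vwpDual_comp_swap)
open Literature.NumberTheory.Transcendental (zetaValue)

/-! ### The level-5 vectors of (22) -/

/-- The level-5 parameter vector of the `k`-th companion integral of (22):
`B(k) = (p₁+q₁+q₂; p₀, p₃−k, p₁, q₂, p₁+q₁−p₂)` (zero beyond slot 5), `(p;q) = (p(a);q(a))`.  By Zudilin 2002 (k = 3),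
`J₃(p₀,p₁,p₂,p₃−k; q₁,q₂,q₃−p₆+k) = λ_k · F̃₅(B(k))` (`J3_eq_vwpDual_five`). -/
def bFive (a : Fin 8 → ℤ) (k : ℤ) : ℕ → ℤ := fun s =>
  if s = 0 then pOf a 1 + qOf a 0 + qOf a 1 else if s = 1 then pOf a 0 else if s = 2 then pOf a 3 - k
  else if s = 3 then pOf a 1 else if s = 4 then qOf a 1 else if s = 5 then pOf a 1 + qOf a 0 - pOf a 2 else 0

/-- Zudilin's prefactor `λ(B) = c₁₂! c₂₃! c₃₄! c₄₅! / (B₁! B₅!)` (`c_jl = B₀ − B_j − B_l`) of a level-5 vector, as a rational. -/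
def lamOf (B : ℕ → ℤ) : ℚ :=
  facQ (B 0 - B 1 - B 2) * facQ (B 0 - B 2 - B 3) * facQ (B 0 - B 3 - B 4) * facQ (B 0 - B 4 - B 5) /
    (facQ (B 1) * facQ (B 5))

/-- `λ_k = λ(B(k))`. -/
def lamQ (a : Fin 8 → ℤ) (k : ℤ) : ℚ := lamOf (bFive a k)

/-! ### (i) The `J₃ ↔ F̃₅` dictionary (Zudilin 2002, k = 3) -/

/-- `Γ(c + 1) = c!` for an integer `c ≥ 0`. -/
theorem Gamma_int_add_one {c : ℤ} (hc : 0 ≤ c) : Real.Gamma ((c : ℝ) + 1) = (c.toNat.factorial : ℝ) := by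
  obtain ⟨n, rfl⟩ := Int.eq_ofNat_of_zero_le hc
  simp [Real.Gamma_nat_eq_factorial]

/-- `sorokinIntegral 3` only reads its parameter functions below `3`. -/
theorem sorokinIntegral_congr3 {a₀ a₀' : ℝ} {f f' g g' : ℕ → ℝ} (h0 : a₀ = a₀')
    (hf : ∀ i < 3, f i = f' i) (hg : ∀ i < 3, g i = g' i) :
    sorokinIntegral 3 a₀ f g = sorokinIntegral 3 a₀' f' g' := by
  subst h0
  unfold Literature.NumberTheory.Irrationality.Zudilin2002.sorokinIntegral
    Literature.NumberTheory.Irrationality.Zudilin2002.sorokinIntegrand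
  congr 1
  funext x
  congr 1
  exact Finset.prod_congr rfl fun j _ => by rw [hf j j.isLt, hg j j.isLt]

/-- **(i)** For strictly admissible `B(k)`: `J₃(p₀,p₁,p₂,p₃−k; q₁,q₂,q₃−p₆+k) = λ_k · F̃₅(B(k))` (from the cited Zudilin 2002 theorem,
k = 3; the relation `p₃ + q₃ = p₆ + q₁ + q₂` of (18) holds identically on the 8-parameter family). -/
theorem Gamma_pair (B : ℕ → ℤ) {j l : ℕ} (hj : j ≠ 0) (hl : l ≠ 0) (hc : 0 ≤ B 0 - B j - B l) :
    Real.Gamma (1 + hOfB B 0 - hOfB B j - hOfB B l) = ((B 0 - B j - B l).toNat.factorial : ℝ) := by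
  rw [show (1 + hOfB B 0 - hOfB B j - hOfB B l) = ((B 0 - B j - B l : ℤ) : ℝ) + 1 by
    simp [hOfB, hj, hl]; ring]
  exact Gamma_int_add_one hc

/-- `Γ(h_j) = B_j!` for a slot parameter `B_j ≥ 0` (`h_j = B_j + 1`). -/
theorem Gamma_slot (B : ℕ → ℤ) {j : ℕ} (hj : j ≠ 0) (hc : 0 ≤ B j) :
    Real.Gamma (hOfB B j) = ((B j).toNat.factorial : ℝ) := by
  rw [show hOfB B j = ((B j : ℤ) : ℝ) + 1 by simp [hOfB, hj]]
  exact Gamma_int_add_one hc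

/-- Zudilin 2002 (k = 3) in Brown–Zudilin's coordinates, for STRICTLY ADMISSIBLE integer `B`:
`λ(B) · F̃₅(B) = J₃(B₁+1; B₂+1, B₃+1, B₄+1 | B₀−B₃+2, B₀−B₄+2, B₀−B₅+2)`. -/
theorem vwpDual_five_eq_J (hZ : vwp_eq_integral_of_pos) (B : ℕ → ℤ) (hB : Admissible B) :
    (lamOf B : ℝ) * vwpDual 5 B =
      sorokinIntegral 3 ((B 1 : ℝ) + 1) (fun i => (B (i + 2) : ℝ) + 1) (fun i => (B 0 : ℝ) - B (i + 3) + 2) := by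
  have h16 := hB
  unfold Admissible cParams at h16
  simp only [List.mem_cons, List.not_mem_nil, or_false, forall_eq_or_imp, forall_eq] at h16
  obtain ⟨c1, c2, c3, c4, c5, cS, c12, c13, c14, c15, c23, c24, c25, c34, c35, c45⟩ := h16
  have r0 : (0 : ℝ) < B 0 := by exact_mod_cast (show 0 < B 0 by omega)
  have r1 : (0 : ℝ) < B 1 := by exact_mod_cast c1
  have r2 : (0 : ℝ) < B 2 := by exact_mod_cast c2
  have r3 : (0 : ℝ) < B 3 := by exact_mod_cast c3
  have r4 : (0 : ℝ) < B 4 := by exact_mod_cast c4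
  have r5 : (0 : ℝ) < B 5 := by exact_mod_cast c5
  have rS : ((B 1 : ℤ) : ℝ) + B 2 + B 3 + B 4 + B 5 < 2 * B 0 := by exact_mod_cast (show B 1 + B 2 + B 3 + B 4 + B 5 < 2 * B 0 by omega)
  have r12 : ((B 1 : ℤ) : ℝ) + B 2 < B 0 := by exact_mod_cast (show B 1 + B 2 < B 0 by omega)
  have r23 : ((B 2 : ℤ) : ℝ) + B 3 < B 0 := by exact_mod_cast (show B 2 + B 3 < B 0 by omega)
  have r34 : ((B 3 : ℤ) : ℝ) + B 4 < B 0 := by exact_mod_cast (show B 3 + B 4 < B 0 by omega)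
  have r45 : ((B 4 : ℤ) : ℝ) + B 5 < B 0 := by exact_mod_cast (show B 4 + B 5 < B 0 by omega)
  have H := hZ 3 (hOfB B) (by norm_num)
    (by
      rw [show Finset.Icc 1 (3 + 2) = ({1, 2, 3, 4, 5} : Finset ℕ) by decide]
      simp [hOfB]
      linarith)
    (by
      intro j hj
      rw [show Finset.Icc 2 (3 + 1) = ({2, 3, 4} : Finset ℕ) by decide] at hj
      simp only [Finset.mem_insert, Finset.mem_singleton] at hj
      rcases hj with rfl | rfl | rfl <;> simp [hOfB] <;> constructor <;> linarith)
    (by simp [hOfB]; linarith) (by simp [hOfB]; linarith) (by simp [hOfB]; linarith) (by simp [hOfB]; linarith)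
  rw [show Finset.Icc 1 (3 + 1) = ({1, 2, 3, 4} : Finset ℕ) by decide, Finset.prod_insert (by decide),
    Finset.prod_insert (by decide), Finset.prod_insert (by decide), Finset.prod_singleton] at H
  simp only [Nat.reduceAdd] at H
  rw [Gamma_pair B one_ne_zero two_ne_zero c12.le, Gamma_pair B two_ne_zero three_ne_zero c23.le,
    Gamma_pair B three_ne_zero four_ne_zero c34.le, Gamma_pair B four_ne_zero (by norm_num) c45.le,
    Gamma_slot B one_ne_zero c1.le, Gamma_slot B (by norm_num) c5.le] at H
  rw [sorokinIntegral_congr3 (a₀' := hOfB B 1) (f' := fun i => hOfB B (i + 2)) (g' := fun i => 1 + hOfB B 0 - hOfB B (i + 3))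
    (by simp [hOfB]) (fun i _ => by simp [hOfB]) (fun i _ => by simp [hOfB]; ring), ← H]
  unfold Literature.NumberTheory.Irrationality.BrownZudilin2022.vwpDual
  simp only [lamOf, facQ]
  push_cast
  ring

/-- **(i)** For strictly admissible `B(k)`: `J₃(p₀,p₁,p₂,p₃−k; q₁,q₂,q₃−p₆+k) = λ_k · F̃₅(B(k))` (from the cited Zudilin 2002 theorem,
k = 3; the relation `p₃ + q₃ = p₆ + q₁ + q₂` of (18) holds identically on the 8-parameter family). -/
theorem J3_eq_vwpDual_five (hZ : vwp_eq_integral_of_pos) (a : Fin 8 → ℤ) (k : ℤ) (hadm : Admissible (bFive a k)) :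
    J3 (pOf a 0) (pOf a 1) (pOf a 2) (pOf a 3 - k) (qOf a 0) (qOf a 1) (qOf a 2 - pOf a 6 + k) =
      (lamQ a k : ℝ) * vwpDual 5 (bFive a k) := by
  rw [show lamQ a k = lamOf (bFive a k) from rfl, vwpDual_five_eq_J hZ _ hadm]
  unfold J3
  refine sorokinIntegral_congr3 ?_ ?_ ?_
  · simp [bFive]
  · intro i hi
    interval_cases i <;> simp [bFive]
  · intro i hi
    interval_cases i <;> simp [bFive, pOf, qOf] <;> ring

/-! ### (ii)–(iii) Bailey's involution lands on the degenerate shape -/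

/-- The transported level-`N` vector `(N; b₃, b₇−i, b₄, b₆, b₅)`, `i = k − p₄` (zero beyond slot 5). -/
def tShape (a : Fin 8 → ℤ) (k : ℤ) : ℕ → ℤ := fun s =>
  let b := bOfA a
  if s = 0 then b 0 else if s = 1 then b 3 else if s = 2 then b 7 - (k - pOf a 4)
  else if s = 3 then b 4 else if s = 4 then b 6 else if s = 5 then b 5 else 0

/-- **(ii)** `𝔱₁₃₄(B(k)) = (N; b₃, b₇−i, b₄, b₆, b₅)`. -/
theorem tau134_bFive (a : Fin 8 → ℤ) (k : ℤ) : tau134 (bFive a k) = tShape a k := by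
  funext s
  rcases Nat.lt_or_ge s 6 with hs | hs
  · interval_cases s <;> simp [tau134, bFive, tShape, pOf, qOf, bOfA] <;> ring
  · simp [tau134, bFive, tShape, show s ≠ 0 by omega, show s ≠ 1 by omega, show s ≠ 2 by omega,
      show s ≠ 3 by omega, show s ≠ 4 by omega, show s ≠ 5 by omega]

/-- **(iii)** The level-5 series at `(N; b₃, b₇−i, b₄, b₆, b₅)` is the level-7 series at the degenerate shape `degShape b i`
(slot symmetry of `F̃₅` and the cancellation of the slot pair `(N+1, 0)`: `Γ(N+2+μ)/Γ(1+μ) · Γ(1+μ)/Γ(N+2+μ) = 1`). -/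
theorem vwpDual_seven_slot_pair (N : ℤ) (c : ℕ → ℤ) (hN : 0 ≤ N) :
    vwpDual 7 (fun s => if s = 0 then N else if s = 1 then N + 1 else if s = 2 then 0 else c s) =
      vwpDual 5 (fun s => if s = 0 then N else c (s + 2)) := by
  unfold Literature.NumberTheory.Irrationality.BrownZudilin2022.vwpDual Literature.NumberTheory.Irrationality.Zudilin2002.vwpSeries
  congr 1
  funext μ
  have e8 : ((-1 : ℝ)) ^ ((7 + 1) * μ) = 1 := Even.neg_one_pow ⟨4 * μ, by ring⟩
  have e6 : ((-1 : ℝ)) ^ ((5 + 1) * μ) = 1 := Even.neg_one_pow ⟨3 * μ, by ring⟩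
  rw [e8, e6]
  simp only [Finset.prod_range_succ, Finset.prod_range_zero, one_mul, mul_one, hOfB]
  norm_num [-mul_eq_mul_right_iff, -mul_eq_mul_left_iff]
  have hN' : (0 : ℝ) < (N : ℝ) + 2 + μ := by positivity
  have hX : Real.Gamma ((N : ℝ) + 2 + μ) ≠ 0 := (Real.Gamma_pos_of_pos hN').ne'
  have hY : Real.Gamma (1 + (μ : ℝ)) ≠ 0 := (Real.Gamma_pos_of_pos (by positivity)).ne'
  have hc : Real.Gamma ((N : ℝ) + 2 + μ) / Real.Gamma (1 + (μ : ℝ)) *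
      (Real.Gamma ((N : ℝ) + 2 + μ) / Real.Gamma (1 + (μ : ℝ))) * (Real.Gamma (1 + (μ : ℝ)) / Real.Gamma ((N : ℝ) + 2 + μ)) =
      Real.Gamma ((N : ℝ) + 2 + μ) / Real.Gamma (1 + (μ : ℝ)) := by
    field_simp
  have h1 : Real.Gamma ((N : ℝ) + 1 + 1 + μ) = Real.Gamma ((N : ℝ) + 2 + μ) := by ring_nf
  have h2 : Real.Gamma (1 + ((N : ℝ) + 2) - ((N : ℝ) + 1 + 1) + μ) = Real.Gamma (1 + (μ : ℝ)) := by ring_nf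
  rw [h1, h2, hc]

/-- `degShape b i` has the slot pair `(N+1, 0)` in front. -/
theorem degShape_eq (b : ℕ → ℤ) (i : ℤ) :
    degShape b i = fun s => if s = 0 then b 0 else if s = 1 then b 0 + 1 else if s = 2 then 0 else degShape b i s := by
  funext s
  by_cases h0 : s = 0
  · subst h0; simp [degShape]
  by_cases h1 : s = 1
  · subst h1; simp [degShape]
  by_cases h2 : s = 2
  · subst h2; simp [degShape]
  simp [h0, h1, h2]

/-- The transported vector, permuted into the slot order of `degShape`. -/
theorem tShape_perm (a : Fin 8 → ℤ) (k : ℤ) :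
    (tShape a k ∘ Equiv.swap 2 3) ∘ Equiv.swap 3 5 =
      fun s => if s = 0 then bOfA a 0 else degShape (bOfA a) (k - pOf a 4) (s + 2) := by
  funext s
  have s20 : Equiv.swap (2 : ℕ) 3 0 = 0 := Equiv.swap_apply_of_ne_of_ne (by norm_num) (by norm_num)
  have s21 : Equiv.swap (2 : ℕ) 3 1 = 1 := Equiv.swap_apply_of_ne_of_ne (by norm_num) (by norm_num)
  have s22 : Equiv.swap (2 : ℕ) 3 2 = 3 := Equiv.swap_apply_left _ _
  have s23 : Equiv.swap (2 : ℕ) 3 3 = 2 := Equiv.swap_apply_right _ _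
  have s24 : Equiv.swap (2 : ℕ) 3 4 = 4 := Equiv.swap_apply_of_ne_of_ne (by norm_num) (by norm_num)
  have s25 : Equiv.swap (2 : ℕ) 3 5 = 5 := Equiv.swap_apply_of_ne_of_ne (by norm_num) (by norm_num)
  have s30 : Equiv.swap (3 : ℕ) 5 0 = 0 := Equiv.swap_apply_of_ne_of_ne (by norm_num) (by norm_num)
  have s31 : Equiv.swap (3 : ℕ) 5 1 = 1 := Equiv.swap_apply_of_ne_of_ne (by norm_num) (by norm_num)
  have s32 : Equiv.swap (3 : ℕ) 5 2 = 2 := Equiv.swap_apply_of_ne_of_ne (by norm_num) (by norm_num)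
  have s33 : Equiv.swap (3 : ℕ) 5 3 = 5 := Equiv.swap_apply_left _ _
  have s34 : Equiv.swap (3 : ℕ) 5 4 = 4 := Equiv.swap_apply_of_ne_of_ne (by norm_num) (by norm_num)
  have s35 : Equiv.swap (3 : ℕ) 5 5 = 3 := Equiv.swap_apply_right _ _
  rcases Nat.lt_or_ge s 6 with hs | hs
  · interval_cases s <;>
      simp [Function.comp, tShape, degShape, bOfA, s20, s21, s22, s23, s24, s25, s30, s31, s32, s33, s34, s35]
  · have e3 : Equiv.swap (3 : ℕ) 5 s = s := Equiv.swap_apply_of_ne_of_ne (by omega) (by omega)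
    have e2 : Equiv.swap (2 : ℕ) 3 s = s := Equiv.swap_apply_of_ne_of_ne (by omega) (by omega)
    simp only [Function.comp, e3, e2, tShape, degShape, show s ≠ 0 by omega, if_false, show s + 2 ≠ 1 by omega,
      show s + 2 ≠ 2 by omega]
    obtain ⟨n, rfl⟩ : ∃ n, s = n + 6 := ⟨s - 6, by omega⟩
    simp [bOfA]

/-- (iii) The level-5 series at `𝔱₁₃₄B(k) = (N; b₃, b₇−i, b₄, b₆, b₅)` is the level-7 series at the degenerate shape
`degShape b i = (N; N+1, 0, b₃, b₄, b₅, b₆, b₇−i)` (slot symmetry and the cancellation of the slot pair `(N+1, 0)`). -/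
theorem vwpDual_tShape (a : Fin 8 → ℤ) (k : ℤ) (hN : 0 ≤ bOfA a 0) :
    vwpDual 5 (tShape a k) = vwpDual 7 (degShape (bOfA a) (k - pOf a 4)) := by
  have h2 : (2 : ℕ) ∈ Icc 1 5 := by simp
  have h3 : (3 : ℕ) ∈ Icc 1 5 := by simp
  have h5 : (5 : ℕ) ∈ Icc 1 5 := by simp
  rw [← vwpDual_comp_swap 5 (tShape a k) h2 h3, ← vwpDual_comp_swap 5 _ h3 h5, tShape_perm,
    degShape_eq (bOfA a) (k - pOf a 4), vwpDual_seven_slot_pair _ _ hN]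
  rfl

/-- `Π(𝔱B(k)) = b₃! (b₇−i)! b₄! b₆! b₅! (d − c₁₂ + i)!` and `Π(B(k))`, as rationals (`facQ`). -/
def piT (a : Fin 8 → ℤ) (k : ℤ) : ℚ :=
  let b := bOfA a
  let i := k - pOf a 4
  facQ (b 3) * facQ (b 7 - i) * facQ (b 4) * facQ (b 6) * facQ (b 5) * facQ (dOf b - (b 0 - b 1 - b 2) + i)

/-- `Π(B(k))` written out in the slots of `bFive` (rational). -/
def piB (a : Fin 8 → ℤ) (k : ℤ) : ℚ :=
  let B := bFive a k
  facQ (B 1) * facQ (B 2) * facQ (B 3) * facQ (B 4) * facQ (B 5) * facQ (2 * B 0 - (B 1 + B 2 + B 3 + B 4 + B 5))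

/-- `Π(B(k)) = piB a k`. -/
theorem piNorm_bFive (a : Fin 8 → ℤ) (k : ℤ) : (piNorm (bFive a k) : ℚ) = piB a k := by
  have hs : 2 * bFive a k 0 - ∑ j ∈ range 5, bFive a k (j + 1) =
      2 * bFive a k 0 - (bFive a k 1 + bFive a k 2 + bFive a k 3 + bFive a k 4 + bFive a k 5) := by
    simp only [sum_range_succ, sum_range_zero]; ring
  unfold piNorm piB
  rw [hs]
  simp [prod_range_succ, facQ]

/-- `Π(𝔱₁₃₄B(k)) = piT a k`. -/
theorem piNorm_tShape (a : Fin 8 → ℤ) (k : ℤ) : (piNorm (tShape a k) : ℚ) = piT a k := by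
  have hs : 2 * tShape a k 0 - ∑ j ∈ range 5, tShape a k (j + 1) =
      dOf (bOfA a) - (bOfA a 0 - bOfA a 1 - bOfA a 2) + (k - pOf a 4) := by
    simp [sum_range_succ, tShape, dOf]; ring
  unfold piNorm piT
  rw [hs]
  simp [prod_range_succ, facQ, tShape]

/-! ### (iv) The transport weight identity (a relabelling of factorials) -/

/-- **(iv)** `w_k · λ_k · Π(B(k))/Π(𝔱B(k)) = 2ρ(a)·Ω_{k−p₄}(b(a))` on the support of (22) (all factorial arguments `≥ 0` there). -/
def transportWeight_stmt : Prop :=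
  ∀ (a : Fin 8 → ℤ) (k : ℤ), (∀ i ∈ Icc 1 7, 0 ≤ bOfA a i ∧ 2 * bOfA a i ≤ bOfA a 0 + 1) → 0 ≤ dOf (bOfA a) →
    (∀ i, 0 ≤ pOf a i) → (∀ i, 0 ≤ qOf a i) → k ∈ Icc (pOf a 4) (pOf a 4 + qOf a 3) → pOf a 5 ≤ k → pOf a 6 ≤ k →
    J3TermsConverge (pOf a) (qOf a) → Admissible (bFive a k) →
    (w22 (pOf a) (qOf a) k : ℚ) * lamQ a k * piB a k =
      2 * rhoOf a * ldWeight (bOfA a) (k - pOf a 4) * piT a k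

/-- A `zchoose` binomial inside its support as a quotient of factorials (`facQ`). -/
theorem zchoose_facQ {n m : ℤ} (h0 : 0 ≤ m) (h1 : m ≤ n) :
    ((zchoose n m : ℤ) : ℚ) = facQ n / (facQ m * facQ (n - m)) := by
  unfold Literature.NumberTheory.Irrationality.BrownZudilin2022.zchoose
  rw [if_pos ⟨h0, h1⟩]
  push_cast
  rw [Nat.cast_choose ℚ (by omega : m.toNat ≤ n.toNat), show n.toNat - m.toNat = (n - m).toNat by omega]
  simp [facQ]

/-- `(−1)^x = (−1)^y` for integers `x ≡ y (mod 2)`. -/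
theorem neg_one_zpow_eq_of_even_sub {x y : ℤ} (h : Even (x - y)) : (-1 : ℚ) ^ x = (-1 : ℚ) ^ y := by
  obtain ⟨m, hm⟩ := h
  rw [show x = y + (m + m) by omega, zpow_add₀ (by norm_num), Even.neg_one_zpow ⟨m, rfl⟩, mul_one]

/-- `∏_{j=3}^{6} f j` written out. -/
theorem prod_Icc_three_six (f : ℕ → ℚ) : ∏ j ∈ Icc 3 6, f j = f 3 * f 4 * f 5 * f 6 := by
  rw [show Finset.Icc 3 6 = ({3, 4, 5, 6} : Finset ℕ) by decide, Finset.prod_insert (by decide),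
    Finset.prod_insert (by decide), Finset.prod_insert (by decide), Finset.prod_singleton]
  ring

/-- **(iv) The transport weight identity** `w_k·λ_k·Π(B(k)) = 2ρ(a)·Ω_i(b)·Π(𝔱B(k))`: after the binomials are written as
factorials and all parameters in the coordinates `a`, both sides are the same rational function of the same factorials
(the three signs agree by the parity `2(Σ_j b_j − p₄)`); `ring_nf` + `field_simp`. -/
theorem transportWeight : transportWeight_stmt := by
  intro a k hreg hd hp hq hk h5 h6 hJ hadm
  -- coordinates
  have ep0 : pOf a 0 = a 4 + a 5 - a 7 := by simp [pOf]
  have ep1 : pOf a 1 = a 1 + a 2 + a 5 - a 3 - a 7 := by simp [pOf]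
  have ep2 : pOf a 2 = a 5 := by simp [pOf]
  have ep3 : pOf a 3 = a 1 + a 2 + a 5 - a 7 := by simp [pOf]
  have ep4 : pOf a 4 = a 6 := by simp [pOf]
  have ep5 : pOf a 5 = a 2 + a 5 - a 7 := by simp [pOf]
  have ep6 : pOf a 6 = a 0 + a 1 + a 5 - a 3 - a 7 := by simp [pOf]
  have eq0 : qOf a 0 = a 3 := by simp [qOf]
  have eq1 : qOf a 1 = a 4 := by simp [qOf]
  have eq2 : qOf a 2 = a 0 + a 4 - a 2 := by simp [qOf]
  have eq3 : qOf a 3 = a 0 := by simp [qOf]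
  have eq4 : qOf a 4 = a 1 := by simp [qOf]
  have eb0 : bOfA a 0 = a 1 + a 2 + a 3 := rfl
  have eb1 : bOfA a 1 = -a 0 + a 2 + a 3 := rfl
  have eb2 : bOfA a 2 = a 1 := rfl
  have eb3 : bOfA a 3 = a 3 := rfl
  have eb4 : bOfA a 4 = a 1 + a 2 - a 4 := rfl
  have eb5 : bOfA a 5 = a 1 + a 2 - a 7 := rfl
  have eb6 : bOfA a 6 = a 3 - a 5 + a 7 := rfl
  have eb7 : bOfA a 7 = a 1 + a 2 + a 5 - a 6 - a 7 := rfl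
  have eB0 : bFive a k 0 = pOf a 1 + qOf a 0 + qOf a 1 := by simp [bFive]
  have eB1 : bFive a k 1 = pOf a 0 := by simp [bFive]
  have eB2 : bFive a k 2 = pOf a 3 - k := by simp [bFive]
  have eB3 : bFive a k 3 = pOf a 1 := by simp [bFive]
  have eB4 : bFive a k 4 = qOf a 1 := by simp [bFive]
  have eB5 : bFive a k 5 = pOf a 1 + qOf a 0 - pOf a 2 := by simp [bFive]
  -- integer facts
  have hk' := mem_Icc.1 hk
  obtain ⟨j1, j2, j3, j4⟩ := hJ k hk h6
  have hp0 := hp 0; have hp1 := hp 1; have hp2 := hp 2; have hp3 := hp 3; have hp4 := hp 4; have hp5 := hp 5; have hp6 := hp 6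
  have hq0 := hq 0; have hq1 := hq 1; have hq2 := hq 2; have hq3 := hq 3; have hq4 := hq 4
  have hS0 : 0 ≤ ∑ j ∈ range 7, bOfA a (j + 1) :=
    Finset.sum_nonneg fun j hj => (hreg (j + 1) (by have := mem_range.1 hj; simp only [mem_Icc]; omega)).1
  have hX0 : 0 ≤ pOf a 4 + pOf a 5 + pOf a 6 + k := by omega
  have hk5 : k - pOf a 5 ≤ qOf a 4 := by rw [ep5, eq4]; rw [ep3] at j1; omega
  -- the binomials as factorials
  have hw : (w22 (pOf a) (qOf a) k : ℚ) = (-1 : ℚ) ^ (pOf a 4 + pOf a 5 + pOf a 6 + k).toNat *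
      (facQ k / (facQ (pOf a 6) * facQ (k - pOf a 6))) * (facQ (qOf a 3) / (facQ (k - pOf a 4) * facQ (qOf a 3 - (k - pOf a 4)))) *
      (facQ (qOf a 4) / (facQ (k - pOf a 5) * facQ (qOf a 4 - (k - pOf a 5)))) := by
    unfold w22
    push_cast
    rw [zchoose_facQ (hp 6) h6, zchoose_facQ (by omega) (by omega), zchoose_facQ (by omega) hk5]
  -- the signs: `sign(w) = sign(ρ) · sign(Ω)`
  have hsign : (-1 : ℚ) ^ (pOf a 4 + pOf a 5 + pOf a 6 + k).toNat =
      (-1 : ℚ) ^ (∑ j ∈ range 7, bOfA a (j + 1)).toNat *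
        (-1 : ℚ) ^ (bOfA a 0 - bOfA a 1 - bOfA a 6 + (bOfA a 0 - bOfA a 2 - bOfA a 6) + (k - pOf a 4) +
          ∑ j ∈ range 7, bOfA a (j + 1)) := by
    rw [← zpow_natCast, ← zpow_natCast, Int.toNat_of_nonneg hX0, Int.toNat_of_nonneg hS0, ← zpow_add₀ (by norm_num)]
    apply neg_one_zpow_eq_of_even_sub
    refine ⟨pOf a 4 - ∑ j ∈ range 7, bOfA a (j + 1), ?_⟩
    simp only [sum_range_succ, sum_range_zero, ep4, ep5, ep6, eb0, eb1, eb2, eb3, eb4, eb5, eb6, eb7]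
    ring
  rw [hw, hsign]
  simp only [lamQ, lamOf, piB, piT, rhoOf, ldWeight, Epairs, List.map, List.prod_cons, List.prod_nil, prod_Icc_three_six,
    dOf_bOfA, eB0, eB1, eB2, eB3, eB4, eB5, facQ]
  simp only [sum_range_succ, sum_range_zero, ep0, ep1, ep2, ep3, ep4, ep5, ep6, eq0, eq1, eq3, eq4,
    eb0, eb1, eb2, eb3, eb4, eb5, eb6, eb7]
  ring_nf
  field_simp


end Summit.KontsevichZagierPeriods.Zeta5Search.WedgeDictionary
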